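import Summits.ABC.ABC.Theorems.DefiniteXiFreyModularityStubFreyCaseBThreeReducible
import Summits.ABC.ABC.Theorems.DefiniteXiFreyModularityStubFreySemistableDichotomy
import Summits.ABC.ABC.Theorems.DefiniteXiFreyModularityStubFreyFiveIrreducibleGlue
import Literature.NumberTheory.EllipticCurves.QuadraticTwistFramedTorsion
import Literature.NumberTheory.Automorphic.BCDTTheoremBNormalisedAssembly
import HarnessLib

/-!
# Crux `FreyModularity` (stmt-ABC-11340), line `Sketch`: in case B, `ρ̄_{E,3}` is reducible for
# EVERY Frey curve (no normalisation)

Support file for the crux `Summit.ABC.ABC.Theses.DefiniteXi.FreyModularity` (every Frey curve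
`E_(a,b) : y² = x(x - a)(x + b)` is modular), line `Sketch`, registered side stub
`stub_freyCaseBThreeReducibleAll` (S17, reshape 7, lead `c52`).  S14
(`stub_freyCaseBThreeReducible`, p163490) proved that on the NORMALISED family (`A ≡ -1 (mod 4)`,
`2 ∣ B`) case B — no framed model of `E[3]` absolutely irreducible over `ℚ(√-3)` — forces `E[3]`
to be reducible.  A general Frey curve `E_(a,b)` is a translate, or the quadratic twist by `-1`
of a translate, of a normalised one (Diamond–Kramer 1995, Lemma 1); this file transports case B
along these symmetries and concludes for all coprime `a, b` with `ab(a+b) ≠ 0`: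

* `isAbsIrreducibleOverSqrt_twist_iff` — "`ρ̄|_{ℚ(√d)}` absolutely irreducible" is invariant under
  twisting `ρ̄` by a continuous character (restriction commutes with twisting;
  `FramedRep.isAbsolutelyIrreducible_twist_iff`);
* `isTorsionGaloisRep_smul_iff`, `caseBThree_smul_iff` — framed models of `E[p]`, hence case B,
  are invariant under a change of Weierstrass equation (`E[p] ≅ (C • E)[p]` equivariantly,
  `exists_geomTorsion_addEquiv_smul`);
* `caseBThree_quadraticTwist` — case B passes to every quadratic twist `E^{(d)}`: a framed model
  `ρ̄'` of `E^{(d)}[3]` gives the framed model `ρ̄' ⊗ χ_d` of `E[3]` (the tree's new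
  `isTorsionGaloisRep_of_quadraticTwist_twist`, `QuadraticTwistFramedTorsion`), which is not
  absolutely irreducible over `ℚ(√-3)` in case B, hence neither is `ρ̄'`;
* `caseBThree_freyCurve_translate_iff`, `caseBThree_freyCurve_swap`, `caseBThree_freyCurve_neg`,
  `exists_normalised_freyCurve_caseB` — the six presentations `E_(±a,±b)`, `E_(b,a)`, … and the
  normalisation, carrying case B and (ir)reducibility of `E[3]`;
* `stub_freyCaseBThreeReducibleAll` (S17) — case B ⇒ `E_(a,b)[3]` has a `Γ_ℚ`-stable line, for
  every coprime `a, b` with `ab(a+b) ≠ 0`.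

Side stub: it does not feed `FreyModularity_of`.  Nothing is defined; no named fact is used.

## References

* [DiamondKramer1995] F. Diamond, K. Kramer, Math. Res. Lett. 2 (1995), Lemma 1.
* [Serre1972] J.-P. Serre, Invent. Math. 15 (1972), §5.4 Prop. 21.
* [SilvermanAEC2009] J. H. Silverman, *The Arithmetic of Elliptic Curves*, X.5 Cor. 5.4.
-/

-- `Summit.<Summit>.<Problem>` is the mandated summit-side namespace (CONVENTIONS §2); for the
-- single-conjunct summit `ABC` the two coincide, so the duplicate `ABC.ABC` is deliberate.
set_option linter.dupNamespace false

noncomputable section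

open scoped MatrixGroups NumberField

open Matrix Field IsDedekindDomain
open Literature.NumberTheory.EllipticCurves
open Literature.NumberTheory.Automorphic
open Literature.NumberTheory.Automorphic.BCDT
open Literature.NumberTheory.GaloisRepresentations
open Literature.NumberTheory.DiophantineGeometry
open WeierstrassCurve

namespace Summit.ABC.ABC.Theorems

/-! ## Twists and changes of equation preserve case B -/

/-- **"`ρ̄|_{ℚ(√d)}` absolutely irreducible" is invariant under twisting by a character.**  For a
continuous character `χ : Γ_ℚ → kˣ`, `(ρ̄ ⊗ χ)|_{Γ_L} = ρ̄|_{Γ_L} ⊗ χ|_{Γ_L}` (definitionally), and a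
representation and its twists have the same invariant subspaces after every base change
(`FramedRep.isAbsolutelyIrreducible_twist_iff`). [folklore] -/
theorem isAbsIrreducibleOverSqrt_twist_iff {k : Type} [Field k] [TopologicalSpace k]
    [IsTopologicalRing k] (ρ : ModPGaloisRep ℚ k 2) (χ : absoluteGaloisGroup ℚ →ₜ* kˣ) (d : ℚ) :
    ModPGaloisRep.IsAbsIrreducibleOverSqrt d (FramedRep.twist ρ χ) ↔ ρ.IsAbsIrreducibleOverSqrt d := by
  have key : ∀ (L : Type) [Field L] [Algebra ℚ L],
      FramedGaloisRep.restrictField L (FramedRep.twist ρ χ) =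
        FramedRep.twist (FramedGaloisRep.restrictField L ρ) (χ.comp (absGaloisRestrict ℚ L)) :=
    fun L _ _ ↦ ContinuousMonoidHom.ext fun _ ↦ rfl
  refine ⟨fun h L _ _ _ ↦ ?_, fun h L _ _ _ ↦ ?_⟩
  · have h' := h L
    rw [key] at h'
    exact (FramedRep.isAbsolutelyIrreducible_twist_iff _ _).mp h'
  · rw [key]
    exact (FramedRep.isAbsolutelyIrreducible_twist_iff _ _).mpr (h L)

/-- **Framed models of `E[p]` do not see a change of Weierstrass equation**: `(C • E)[p] ≅ E[p]`
equivariantly (`exists_geomTorsion_addEquiv_smul`), so `ρ̄` frames `(C • E)[p]` iff it frames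
`E[p]`. [cite: SilvermanAEC2009, III.3.1(b)] -/
theorem isTorsionGaloisRep_smul_iff {F : Type} [Field F] (W : WeierstrassCurve F)
    (C : VariableChange F) {p : ℕ} (ρ : FramedGaloisRep F (ZMod p) 2) :
    (C • W).IsTorsionGaloisRep p ρ ↔ W.IsTorsionGaloisRep p ρ := by
  obtain ⟨e, he⟩ := exists_geomTorsion_addEquiv_smul W C p
  refine ⟨fun ⟨e', he'⟩ ↦ ⟨e.trans e', fun σ P ↦ ?_⟩, fun ⟨e', he'⟩ ↦ ⟨e.symm.trans e', fun σ Q ↦ ?_⟩⟩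
  · rw [AddEquiv.trans_apply, AddEquiv.trans_apply, he, he']
  · have hQ : e.symm (σ • Q) = σ • e.symm Q := by
      apply e.injective
      rw [AddEquiv.apply_symm_apply, he, AddEquiv.apply_symm_apply]
    rw [AddEquiv.trans_apply, AddEquiv.trans_apply, hQ, he']

/-- **Case B at `3` does not see a change of Weierstrass equation** (`isTorsionGaloisRep_smul_iff`).
[folklore] -/
theorem caseBThree_smul_iff (W : WeierstrassCurve ℚ) (C : VariableChange ℚ) :
    (∀ ρ₃ : ModPGaloisRep ℚ (ZMod 3) 2, (C • W).IsTorsionGaloisRep 3 ρ₃ →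
      ¬ ρ₃.IsAbsIrreducibleOverSqrt (-3)) ↔
    (∀ ρ₃ : ModPGaloisRep ℚ (ZMod 3) 2, W.IsTorsionGaloisRep 3 ρ₃ →
      ¬ ρ₃.IsAbsIrreducibleOverSqrt (-3)) :=
  ⟨fun h ρ₃ hρ₃ ↦ h ρ₃ ((isTorsionGaloisRep_smul_iff W C ρ₃).mpr hρ₃),
    fun h ρ₃ hρ₃ ↦ h ρ₃ ((isTorsionGaloisRep_smul_iff W C ρ₃).mp hρ₃)⟩

/-- **Case B at `3` passes to quadratic twists.**  If no framed model of `E[3]` is absolutely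
irreducible over `ℚ(√-3)`, the same holds for `E^{(d)}` (`d ≠ 0`): a framed model `ρ̄'` of
`E^{(d)}[3]` yields the framed model `ρ̄' ⊗ χ_d` of `E[3]`
(`isTorsionGaloisRep_of_quadraticTwist_twist`, with the continuous quadratic character `χ_d` of
`exists_continuousQuadraticCharacter`), not absolutely irreducible over `ℚ(√-3)` by hypothesis,
and absolute irreducibility over `ℚ(√-3)` is twist-invariant (`isAbsIrreducibleOverSqrt_twist_iff`).
[cite: SilvermanAEC2009, X.5 Cor. 5.4] -/
theorem caseBThree_quadraticTwist (W : WeierstrassCurve ℚ) {d : ℚ} (hd : d ≠ 0)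
    (hB : ∀ ρ₃ : ModPGaloisRep ℚ (ZMod 3) 2, W.IsTorsionGaloisRep 3 ρ₃ →
      ¬ ρ₃.IsAbsIrreducibleOverSqrt (-3)) :
    ∀ ρ₃ : ModPGaloisRep ℚ (ZMod 3) 2, (W.quadraticTwist d).IsTorsionGaloisRep 3 ρ₃ →
      ¬ ρ₃.IsAbsIrreducibleOverSqrt (-3) := by
  intro ρ' hρ' habs
  haveI : Fact (Nat.Prime 3) := ⟨Nat.prime_three⟩
  haveI : NeZero (2 : ℚ) := ⟨by norm_num⟩
  obtain ⟨χ, h1, h2, -⟩ := exists_continuousQuadraticCharacter hd (ZMod 3)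
  exact hB _ (isTorsionGaloisRep_of_quadraticTwist_twist hd χ h1 h2 hρ')
    ((isAbsIrreducibleOverSqrt_twist_iff ρ' χ (-3)).mpr habs)

/-! ## The six presentations of a Frey curve -/

/-- `E_(−A, A+B) ≅ E_(A,B)` (translation by the `2`-torsion point `(A, 0)`, `translate_freyCurve`),
so the two are in case B together. [cite: DiamondKramer1995, Lemma 1] -/
theorem caseBThree_freyCurve_translate_iff (A B : ℤ) :
    (∀ ρ₃ : ModPGaloisRep ℚ (ZMod 3) 2, (freyCurve (-A) (A + B)).IsTorsionGaloisRep 3 ρ₃ →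
      ¬ ρ₃.IsAbsIrreducibleOverSqrt (-3)) ↔
    (∀ ρ₃ : ModPGaloisRep ℚ (ZMod 3) 2, (freyCurve A B).IsTorsionGaloisRep 3 ρ₃ →
      ¬ ρ₃.IsAbsIrreducibleOverSqrt (-3)) := by
  rw [← translate_freyCurve A B]
  exact caseBThree_smul_iff (freyCurve A B) _

/-- `E_(B,A) = E_(A,B)^{(−1)}` (`quadraticTwist_freyCurve_neg_one`), so case B for `E_(A,B)`
gives case B for `E_(B,A)` (`caseBThree_quadraticTwist`). [cite: DiamondKramer1995, Lemma 1] -/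
theorem caseBThree_freyCurve_swap (A B : ℤ)
    (hB : ∀ ρ₃ : ModPGaloisRep ℚ (ZMod 3) 2, (freyCurve A B).IsTorsionGaloisRep 3 ρ₃ →
      ¬ ρ₃.IsAbsIrreducibleOverSqrt (-3)) :
    ∀ ρ₃ : ModPGaloisRep ℚ (ZMod 3) 2, (freyCurve B A).IsTorsionGaloisRep 3 ρ₃ →
      ¬ ρ₃.IsAbsIrreducibleOverSqrt (-3) := by
  rw [← quadraticTwist_freyCurve_neg_one A B]
  exact caseBThree_quadraticTwist (freyCurve A B) (by norm_num) hB

/-- `E_(−A,−B) = E_(B,A)` (`freyCurve_swap`), so case B for `E_(A,B)` gives case B for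
`E_(−A,−B)`. [cite: DiamondKramer1995, Lemma 1] -/
theorem caseBThree_freyCurve_neg (A B : ℤ)
    (hB : ∀ ρ₃ : ModPGaloisRep ℚ (ZMod 3) 2, (freyCurve A B).IsTorsionGaloisRep 3 ρ₃ →
      ¬ ρ₃.IsAbsIrreducibleOverSqrt (-3)) :
    ∀ ρ₃ : ModPGaloisRep ℚ (ZMod 3) 2, (freyCurve (-A) (-B)).IsTorsionGaloisRep 3 ρ₃ →
      ¬ ρ₃.IsAbsIrreducibleOverSqrt (-3) := by
  rw [← freyCurve_swap A B]
  exact caseBThree_freyCurve_swap A B hB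

/-! ## Normalisation carrying case B -/

/-- Sign fix carrying case B: if `A` is odd and `2 ∣ B`, either `(A, B)` or `(−A, −B)` is
normalised; case B and (ir)reducibility of `E[3]` go along. [cite: DiamondKramer1995, Lemma 1] -/
theorem exists_normalised_freyCurve_caseB_of_odd {A B : ℤ} (hAB : IsCoprime A B)
    (h0 : A * B * (A + B) ≠ 0) (hA : ¬ (2 : ℤ) ∣ A) (h2 : (2 : ℤ) ∣ B)
    (hB : ∀ ρ₃ : ModPGaloisRep ℚ (ZMod 3) 2, (freyCurve A B).IsTorsionGaloisRep 3 ρ₃ →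
      ¬ ρ₃.IsAbsIrreducibleOverSqrt (-3)) :
    ∃ A' B' : ℤ, IsCoprime A' B' ∧ A' * B' * (A' + B') ≠ 0 ∧ A' ≡ -1 [ZMOD 4] ∧ (2 : ℤ) ∣ B' ∧
      (∀ ρ₃ : ModPGaloisRep ℚ (ZMod 3) 2, (freyCurve A' B').IsTorsionGaloisRep 3 ρ₃ →
        ¬ ρ₃.IsAbsIrreducibleOverSqrt (-3)) ∧
      ((freyCurve A B).HasIrreducibleModPGaloisRep 3 ↔
        (freyCurve A' B').HasIrreducibleModPGaloisRep 3) := by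
  by_cases h4 : A ≡ -1 [ZMOD 4]
  · exact ⟨A, B, hAB, h0, h4, h2, hB, Iff.rfl⟩
  · refine ⟨-A, -B, hAB.neg_neg, ?_, ?_, (dvd_neg).mpr h2, caseBThree_freyCurve_neg A B hB,
      (hasIrreducibleModPGaloisRep_freyCurve_neg_iff A B 3).symm⟩
    · have : (-A) * (-B) * (-A + -B) = -(A * B * (A + B)) := by ring
      rw [this]; exact neg_ne_zero.mpr h0
    · unfold Int.ModEq at h4 ⊢
      omega

/-- **Normalisation of a Frey curve carrying case B** (Diamond–Kramer 1995, Lemma 1): for coprime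
`a, b` with `ab(a+b) ≠ 0` in case B at `3` there are coprime `A, B` with `AB(A+B) ≠ 0`,
`A ≡ −1 (mod 4)`, `2 ∣ B`, `E_(A,B)` in case B, and `E_(a,b)[3]` irreducible iff `E_(A,B)[3]` is
(exactly one of `a, b, a + b` is even; move it to the `B`-slot by a translation or the `−1` twist
— `caseBThree_freyCurve_translate_iff`, `caseBThree_freyCurve_swap` — then fix the sign of `A`).
[cite: DiamondKramer1995, Lemma 1] -/
theorem exists_normalised_freyCurve_caseB {a b : ℤ} (hab : IsCoprime a b)
    (h0 : a * b * (a + b) ≠ 0)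
    (hB : ∀ ρ₃ : ModPGaloisRep ℚ (ZMod 3) 2, (freyCurve a b).IsTorsionGaloisRep 3 ρ₃ →
      ¬ ρ₃.IsAbsIrreducibleOverSqrt (-3)) :
    ∃ A B : ℤ, IsCoprime A B ∧ A * B * (A + B) ≠ 0 ∧ A ≡ -1 [ZMOD 4] ∧ (2 : ℤ) ∣ B ∧
      (∀ ρ₃ : ModPGaloisRep ℚ (ZMod 3) 2, (freyCurve A B).IsTorsionGaloisRep 3 ρ₃ →
        ¬ ρ₃.IsAbsIrreducibleOverSqrt (-3)) ∧
      ((freyCurve a b).HasIrreducibleModPGaloisRep 3 ↔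
        (freyCurve A B).HasIrreducibleModPGaloisRep 3) := by
  have hnot := not_two_dvd_and_two_dvd_of_isCoprime hab
  by_cases hb : (2 : ℤ) ∣ b
  · -- `b` even, `a` odd
    exact exists_normalised_freyCurve_caseB_of_odd hab h0 (fun ha ↦ hnot ⟨ha, hb⟩) hb hB
  · by_cases ha : (2 : ℤ) ∣ a
    · -- `a` even, `b` odd: pass to `E_(b,a)` (the `−1` twist)
      have h0' : b * a * (b + a) ≠ 0 := by
        have : b * a * (b + a) = a * b * (a + b) := by ring
        rwa [this]
      obtain ⟨A, B, h1, h2, h3, h4, h5, h6⟩ := exists_normalised_freyCurve_caseB_of_odd hab.symm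
        h0' hb ha (caseBThree_freyCurve_swap a b hB)
      exact ⟨A, B, h1, h2, h3, h4, h5,
        (hasIrreducibleModPGaloisRep_freyCurve_swap_iff a b 3).symm.trans h6⟩
    · -- `a`, `b` odd, `a + b` even: pass to `E_(−a, a+b)` (translation)
      have hab2 : (2 : ℤ) ∣ a + b := by omega
      have h0' : (-a) * (a + b) * (-a + (a + b)) ≠ 0 := by
        have : (-a) * (a + b) * (-a + (a + b)) = -(a * b * (a + b)) := by ring
        rw [this]; exact neg_ne_zero.mpr h0
      have hcop : IsCoprime (-a) (a + b) := by
        have h := (hab.add_mul_left_right 1).neg_left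
        rwa [mul_one, add_comm] at h
      obtain ⟨A, B, h1, h2, h3, h4, h5, h6⟩ := exists_normalised_freyCurve_caseB_of_odd hcop h0'
        (fun h ↦ ha ((dvd_neg).mp h)) hab2 ((caseBThree_freyCurve_translate_iff a b).mpr hB)
      exact ⟨A, B, h1, h2, h3, h4, h5,
        (hasIrreducibleModPGaloisRep_freyCurve_translate_iff a b 3).symm.trans h6⟩

/-! ## The stub -/

/-- **Registered stub `stub_freyCaseBThreeReducibleAll` (crux `FreyModularity`, line `Sketch`,
S17, reshape 7): in case B, `ρ̄_{E,3}` is reducible — for EVERY Frey curve.**  For coprime `a, b`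
with `ab(a+b) ≠ 0`: if no framed model of `E_(a,b)[3]` is absolutely irreducible over `ℚ(√-3)`,
then `E_(a,b)[3]` has a `Γ_ℚ`-stable subgroup other than `0` and `E[3]`
(`¬ HasIrreducibleModPGaloisRep 3`, i.e. `E_(a,b)` admits a rational `3`-isogeny).  Normalise
carrying case B (`exists_normalised_freyCurve_caseB`: translations and the `−1` twist, the latter
via the framed twist model `E^{(−1)}[3] ≅ ρ̄ ⊗ χ₋₁` of `QuadraticTwistFramedTorsion`), then apply
S14 (`stub_freyCaseBThreeReducible`: Serre's Prop. 21 on the semistable normalised curve) and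
carry the stable line back.  Side stub; does not feed `FreyModularity_of`.
[cite: Serre1972, §5.4 Prop. 21] [cite: DiamondKramer1995, Lemma 1] -/
theorem stub_freyCaseBThreeReducibleAll :
    ∀ (a b : ℤ) [(freyCurve a b).IsElliptic], IsCoprime a b → a * b * (a + b) ≠ 0 →
      (∀ ρ₃ : ModPGaloisRep ℚ (ZMod 3) 2, (freyCurve a b).IsTorsionGaloisRep 3 ρ₃ →
        ¬ ρ₃.IsAbsIrreducibleOverSqrt (-3)) →
      ¬ (freyCurve a b).HasIrreducibleModPGaloisRep 3 := by
  intro a b _ hab h0 hB hirr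
  obtain ⟨A, B, hAB, h0', hA, h2, hB', hiff⟩ := exists_normalised_freyCurve_caseB hab h0 hB
  haveI := isElliptic_freyCurve h0'
  obtain ⟨H, hst, hbot, htop, -⟩ := stub_freyCaseBThreeReducible A B hAB h0' hA h2 hB'
  rcases (hiff.mp hirr) H hst with h | h
  · exact hbot h
  · exact htop h

end Summit.ABC.ABC.Theorems

end
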